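import Summits.AtomisticToContinuum.FouriersLaw.Theorems.EmbeddedDrudeMourreNessUniqueApproximation
import Summits.AtomisticToContinuum.FouriersLaw.Theorems.VanishingNoiseTransferNoisyFourierFlipResolventTruncation
import Summits.AtomisticToContinuum.FouriersLaw.Theorems.VanishingNoiseTransferNoisyFourierFlipResolventCross

/-!
# Resolvent identification of weak flip steady states, part 4: the `L¹` defect bound and truncations with small defect (source case)

Helper file for crux `NoisyFourier` (stmt-AtomisticToContinuum-11977, route `VanishingNoiseTransfer`), line
`sector-dirichlet-gluing`, registered stub `stub_flipSteadyState_eq_bind_resolventKernel`. The `ε = 0` file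
`EmbeddedDrudeMourreNessUniqueApproximation.lean`, for a `C²` integrable solution `ρ ≥ 0` of the equation WITH a
continuous integrable source, `L̂ρ + cρ + g = 0`:

* `tendsto_integral_height_abs_atTop` — `∫ |g| [M < ρ] → 0` as `M → ∞`;
* `exists_truncation_defect_le_src` — for every `η > 0` and all `M₀, R₀` there are `M ≥ M₀`, `R ≥ R₀` such that the
  truncation `f = χ(H/R) m_M(ρ)` has defect `∫ |L̂ f + c f + χ(H/R) χ(ρ/M) g| ≤ η` (polynomial volume growth of the
  energy sublevel sets, as for the pinned chain).

No definitions.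
-/

noncomputable section

open MeasureTheory ProbabilityTheory Filter Topology Set
open scoped ContDiff NNReal ENNReal

namespace Summit.AtomisticToContinuum.FouriersLaw.Theorems.NoisyFourier.FlipResolvent

open Literature.MathematicalPhysics.KineticTheory.HeatConduction
open Literature.MathematicalPhysics.KineticTheory Literature.Probability.Process OscillatorChain
open Literature.Analysis.Distribution
open Summit.AtomisticToContinuum.FouriersLaw.Theorems.SubdiffusiveBondHeat
open Summit.AtomisticToContinuum.FouriersLaw.Theorems.NessUnique

variable {N : ℕ}

/-- `∫ |g| [M < ρ] → 0` as `M → ∞` for integrable `g` (dominated convergence). [folklore] -/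
theorem tendsto_integral_height_abs_atTop {ρ g : PhaseSpace N → ℝ} (hρc : Continuous ρ) (hgi : Integrable g) :
    Tendsto (fun M : ℝ => ∫ x, (if M < ρ x then |g x| else 0)) atTop (𝓝 0) := by
  have h := tendsto_integral_filter_of_dominated_convergence (l := atTop)
    (F := fun (M : ℝ) (x : PhaseSpace N) => if M < ρ x then |g x| else 0) (f := fun _ => (0 : ℝ))
    (μ := volume) (fun x => |g x|) ?_ ?_ hgi.abs ?_
  · simpa using h
  · refine Eventually.of_forall fun M => ?_
    have e : (fun x => (if M < ρ x then |g x| else 0)) = {x | M < ρ x}.indicator (fun x => |g x|) := by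
      funext x; simp only [Set.indicator_apply, Set.mem_setOf_eq]
    rw [e]
    exact (hgi.abs.indicator (measurableSet_lt measurable_const hρc.measurable)).aestronglyMeasurable
  · refine Eventually.of_forall fun M => Eventually.of_forall fun x => ?_
    split_ifs
    · rw [Real.norm_eq_abs, abs_abs]
    · simp
  · refine Eventually.of_forall fun x => ?_
    refine tendsto_const_nhds.congr' ?_
    filter_upwards [eventually_ge_atTop (ρ x)] with M hM
    rw [if_neg (not_lt.2 hM)]

section L1

variable {P : OscillatorChain} (hU : ContDiff ℝ ((⊤ : ℕ∞) : WithTop ℕ∞) P.U)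
  (hV : ContDiff ℝ ((⊤ : ℕ∞) : WithTop ℕ∞) P.V) (hN : 0 < N) {T_L T_R : ℝ}
  (hTL : 0 ≤ T_L) (hTR : 0 ≤ T_R) {ρ : PhaseSpace N → ℝ} (hρ : ContDiff ℝ 2 ρ) (hρ0 : ∀ x, 0 ≤ ρ x)
  (hρi : Integrable ρ) {c : ℝ} {g : PhaseSpace N → ℝ} (hg : Continuous g) (hgi : Integrable g)
  (hpde : ∀ x, sdeGenerator (fun y => -P.drift N y) (P.bathVecL N T_L) (P.bathVecR N T_R) ρ x +
    c * ρ x + g x = 0)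

include hU hV hN hTL hTR hρ hρ0 hρi hg hgi hpde in
/-- **The `L¹` bound on the truncation defect with a source.** There are `K₀, K₃, K₄ ≥ 0` such that for all `R ≥ 1`
and `M, δ, ε > 0`, with `f = χ(H/R) m_M(ρ)` and `E = L̂ f + c f + χ(H/R) χ(ρ/M) g`,
`∫ |E| ≤ K₀ ∫ θ_M(ρ) + ∫ |g|[M < ρ] + K₃ ∫ 1_{R ≤ H} ρ + (K₄/√R)(ε (1 + arsinh²(2M/δ)) (∫ρ + δ |{H ≤ 4R}|) + (∫ρ + ∫|g|)/ε)`.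
[folklore] -/
theorem integral_abs_defect_le_src (hP : P.IsConfining) :
    ∃ K₀ K₃ K₄ : ℝ, 0 ≤ K₀ ∧ 0 ≤ K₃ ∧ 0 ≤ K₄ ∧ ∀ (R M δ ε : ℝ), 1 ≤ R → 0 < M → 0 < δ → 0 < ε →
      ∫ x, |sdeGenerator (fun y => -P.drift N y) (P.bathVecL N T_L) (P.bathVecR N T_R)
            (fun y => smoothCutoff (P.hamiltonian N y / R) * ∫ σ in (0:ℝ)..ρ y, smoothCutoff (σ / M)) x +
          c * (smoothCutoff (P.hamiltonian N x / R) * ∫ σ in (0:ℝ)..ρ x, smoothCutoff (σ / M)) +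
          smoothCutoff (P.hamiltonian N x / R) * smoothCutoff (ρ x / M) * g x| ≤
        K₀ * (∫ x, (if M < ρ x then ρ x else 0)) + (∫ x, (if M < ρ x then |g x| else 0)) +
        K₃ * (∫ x, {x | R ≤ P.hamiltonian N x}.indicator ρ x) +
        K₄ / Real.sqrt R * (ε * (1 + Real.arsinh (2 * M / δ) ^ 2) *
            ((∫ x, ρ x) + δ * (volume {x | P.hamiltonian N x ≤ 4 * R}).toReal) + ((∫ x, ρ x) + ∫ x, |g x|) / ε) := by
  have hU2 : ContDiff ℝ 2 P.U := hU.of_le (by norm_cast)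
  have hV2 : ContDiff ℝ 2 P.V := hV.of_le (by norm_cast)
  have hγ := hP.γ_nonneg
  obtain ⟨K₁, hK₁0, hK₁⟩ := abs_generator_energyCutoff_le hU2 hV2 hP.U_nonneg hP.V_nonneg hN hγ hTL hTR
  obtain ⟨K₂, hK₂0, hK₂⟩ := abs_revGenerator_energyCutoff_le hU2 hV2 hP.U_nonneg hP.V_nonneg hN hγ hTL hTR
  obtain ⟨C, hC0, hC⟩ := abs_fderiv_energyCutoff_bathVec_le (P := P) (N := N) hU2 hV2 hP.U_nonneg hP.V_nonneg
  set cLR := |Real.sqrt (2 * P.γ * T_L)| + |Real.sqrt (2 * P.γ * T_R)| with hcLR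
  set Kc := K₁ + |c| + |2 * P.γ - c| with hKc
  have hKc0 : 0 ≤ Kc := by rw [hKc]; positivity
  refine ⟨Kc + |c|, K₂, C * cLR * (1 + Real.pi / 2 * (Kc + 1)), by positivity, hK₂0,
    by positivity, fun R M δ ε hR hM hδ hε => ?_⟩
  have hR0 : 0 < R := by linarith
  set vL := P.bathVecL N T_L with hvL
  set vR := P.bathVecR N T_R with hvR
  set Lr := sdeGenerator (fun y => -P.drift N y) vL vR with hLr
  set a : PhaseSpace N → ℝ := fun y => smoothCutoff (P.hamiltonian N y / R) with ha
  set f : PhaseSpace N → ℝ := fun y => a y * ∫ σ in (0:ℝ)..ρ y, smoothCutoff (σ / M) with hf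
  set m₀ := ∫ x, ρ x with hm₀
  set mg := ∫ x, |g x| with hmg
  set V := (volume {x | P.hamiltonian N x ≤ 4 * R}).toReal with hVdef
  set W := 1 + Real.arsinh (2 * M / δ) ^ 2 with hW
  have hρc : Continuous ρ := hρ.continuous
  have hYc : Continuous fun y => -P.drift N y := (P.contDiff_drift hU hV N).continuous.neg
  have ha2 : ContDiff ℝ 2 a := contDiff_energyCutoff hU2 hV2 N R
  have hac : HasCompactSupport a := hasCompactSupport_energyCutoff hP N hR0
  have hf2 : ContDiff ℝ 2 f := contDiff_truncation hU2 hV2 hρ M R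
  have hfc : HasCompactSupport f := hasCompactSupport_truncation hP M hR0
  set θ : PhaseSpace N → ℝ := fun x => if M < ρ x then ρ x else 0 with hθ
  set θg : PhaseSpace N → ℝ := fun x => if M < ρ x then |g x| else 0 with hθg
  have hθi : Integrable θ := by
    have e : θ = {x | M < ρ x}.indicator ρ := by
      funext x; simp only [hθ, Set.indicator_apply, Set.mem_setOf_eq]
    rw [e]
    exact hρi.indicator (measurableSet_lt measurable_const hρc.measurable)
  have hθgi : Integrable θg := by
    have e : θg = {x | M < ρ x}.indicator (fun x => |g x|) := by
      funext x; simp only [hθg, Set.indicator_apply, Set.mem_setOf_eq]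
    rw [e]
    exact hgi.abs.indicator (measurableSet_lt measurable_const hρc.measurable)
  set g2 : PhaseSpace N → ℝ := fun x => a x * (-(deriv smoothCutoff (ρ x / M) / M) *
    carreDuChamp vL vR ρ ρ x) with hg2
  have hg2i : Integrable g2 :=
    ((ha2.continuous.mul (((((contDiff_smoothCutoff (n := 1)).continuous_deriv le_rfl).comp
      (hρc.div_const M)).div_const M).neg.mul (continuous_carreDuChamp vL vR hρ hρ)))).integrable_of_hasCompactSupport
      hac.mul_right
  set g3 : PhaseSpace N → ℝ := fun x => ρ x * |Lr a x| with hg3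
  have hg3i : Integrable g3 :=
    (hρc.mul (continuous_sdeGenerator _ _ hYc ha2).abs).integrable_of_hasCompactSupport
      (hasCompactSupport_sdeGenerator _ _ hac).abs.mul_left
  set g4 : PhaseSpace N → ℝ := fun x => smoothCutoff (ρ x / M) * |carreDuChamp vL vR a ρ x| with hg4
  have hg4i : Integrable g4 :=
    ((((contDiff_smoothCutoff (n := 0)).continuous.comp (hρc.div_const M))).mul
      (continuous_carreDuChamp vL vR ha2 hρ).abs).integrable_of_hasCompactSupport
      (hasCompactSupport_carreDuChamp vL vR hac ρ).abs.mul_left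
  have hm1c : Continuous fun x => smoothCutoff (ρ x / M) :=
    (contDiff_smoothCutoff (n := 0)).continuous.comp (hρc.div_const M)
  have hEi : Integrable fun x => |Lr f x + c * f x + a x * smoothCutoff (ρ x / M) * g x| :=
    ((((continuous_sdeGenerator _ _ hYc hf2).add (continuous_const.mul hf2.continuous)).add
      ((ha2.continuous.mul hm1c).mul hg)).abs).integrable_of_hasCompactSupport
      (((hasCompactSupport_sdeGenerator _ _ hfc).add (hfc.mul_left)).add (hac.mul_right.mul_right)).abs
  have hpt : ∀ x, |Lr f x + c * f x + a x * smoothCutoff (ρ x / M) * g x| ≤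
      |c| * θ x + (1 / 2) * g2 x + g3 x + g4 x := fun x =>
    abs_defect_truncation_le_src hU2 hV2 hρ hpde hρ0 hM R x
  have hi12 : Integrable (fun x => |c| * θ x + 1 / 2 * g2 x) := by
    exact (hθi.const_mul |c|).add (hg2i.const_mul (1 / 2))
  have hi123 : Integrable (fun x => |c| * θ x + 1 / 2 * g2 x + g3 x) := by exact hi12.add hg3i
  have hi1234 : Integrable (fun x => |c| * θ x + 1 / 2 * g2 x + g3 x + g4 x) := by exact hi123.add hg4i
  have hint : ∫ x, |Lr f x + c * f x + a x * smoothCutoff (ρ x / M) * g x| ≤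
      |c| * (∫ x, θ x) + (1 / 2) * (∫ x, g2 x) + (∫ x, g3 x) + ∫ x, g4 x := by
    have h := integral_mono hEi hi1234 hpt
    rw [integral_add hi123 hg4i, integral_add hi12 hg3i, integral_add (hθi.const_mul |c|)
      (hg2i.const_mul (1 / 2)), integral_const_mul, integral_const_mul] at h
    exact h
  have b2 : (1 / 2) * ∫ x, g2 x ≤ 1 * Kc * (∫ x, θ x) + ∫ x, θg x :=
    half_integral_height_le_src hU hV hN hρ hρ0 hρi hg hgi hpde hP hM hR0 (hK₁ R hR)
  have b3 : ∫ x, g3 x ≤ K₂ * ∫ x, {x | R ≤ P.hamiltonian N x}.indicator ρ x := by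
    rw [← integral_const_mul]
    refine integral_mono hg3i ((hρi.indicator (measurableSet_le measurable_const
      (P.contDiff_hamiltonian hU2 hV2 N).continuous.measurable)).const_mul K₂) fun x => ?_
    exact mul_abs_revGenerator_cutoff_le hρ0 (hK₂ R hR) x
  have b4 : ∫ x, g4 x ≤ C * cLR / Real.sqrt R * (ε * W * (m₀ + δ * V) + Real.pi / 2 * (Kc * m₀ + mg) / ε) :=
    integral_cross_le_src hU hV hN hρ hρ0 hρi hg hgi hpde hP hK₁ hC0 hC hR hM hδ hε
  have hm₀ : 0 ≤ m₀ := integral_nonneg hρ0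
  have hmg0 : 0 ≤ mg := integral_nonneg fun x => abs_nonneg _
  have hV0 : 0 ≤ V := ENNReal.toReal_nonneg
  have hW0 : 0 ≤ W := by positivity
  have b4' : C * cLR / Real.sqrt R * (ε * W * (m₀ + δ * V) + Real.pi / 2 * (Kc * m₀ + mg) / ε) ≤
      C * cLR * (1 + Real.pi / 2 * (Kc + 1)) / Real.sqrt R * (ε * W * (m₀ + δ * V) + (m₀ + mg) / ε) := by
    have hsq : 0 ≤ Real.sqrt R := Real.sqrt_nonneg _
    have hCc : 0 ≤ C * cLR := by positivity
    have hq : 0 ≤ Real.pi / 2 * (Kc + 1) := by positivity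
    have hKm : Kc * m₀ + mg ≤ (Kc + 1) * (m₀ + mg) := by nlinarith
    have h1 : ε * W * (m₀ + δ * V) + Real.pi / 2 * (Kc * m₀ + mg) / ε ≤
        (1 + Real.pi / 2 * (Kc + 1)) * (ε * W * (m₀ + δ * V) + (m₀ + mg) / ε) := by
      set A := ε * W * (m₀ + δ * V) with hA
      set B := (m₀ + mg) / ε with hB
      set q := Real.pi / 2 * (Kc + 1) with hqdef
      have t1 : 0 ≤ A := by rw [hA]; positivity
      have t2 : 0 ≤ B := by rw [hB]; positivity
      have t3 : Real.pi / 2 * (Kc * m₀ + mg) / ε ≤ q * B := by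
        rw [hqdef, hB, mul_div_assoc, mul_assoc]
        refine mul_le_mul_of_nonneg_left ?_ (by positivity)
        rw [← mul_div_assoc]
        exact div_le_div_of_nonneg_right hKm hε.le
      have e : (1 + q) * (A + B) = A + q * B + (B + q * A) := by ring
      rw [e]
      have : 0 ≤ B + q * A := add_nonneg t2 (mul_nonneg hq t1)
      linarith
    calc C * cLR / Real.sqrt R * (ε * W * (m₀ + δ * V) + Real.pi / 2 * (Kc * m₀ + mg) / ε)
        ≤ C * cLR / Real.sqrt R * ((1 + Real.pi / 2 * (Kc + 1)) * (ε * W * (m₀ + δ * V) + (m₀ + mg) / ε)) :=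
          mul_le_mul_of_nonneg_left h1 (div_nonneg hCc hsq)
      _ = _ := by ring
  have b44 := b4.trans b4'
  rw [hW] at b44
  set I := ∫ x, θ x with hI
  set J := ∫ x, θg x with hJ
  set X := ∫ x, {x | R ≤ P.hamiltonian N x}.indicator ρ x with hX
  set Y := C * cLR * (1 + Real.pi / 2 * (Kc + 1)) / Real.sqrt R *
    (ε * (1 + Real.arsinh (2 * M / δ) ^ 2) * (m₀ + δ * V) + (m₀ + mg) / ε) with hY
  have e0 : |c| * I + (1 * Kc * I + J) + K₂ * X + Y = (Kc + |c|) * I + J + K₂ * X + Y := by ring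
  calc ∫ x, |Lr f x + c * f x + a x * smoothCutoff (ρ x / M) * g x|
      ≤ |c| * I + (1 / 2) * (∫ x, g2 x) + (∫ x, g3 x) + ∫ x, g4 x := hint
    _ ≤ |c| * I + (1 * Kc * I + J) + K₂ * X + Y := by
        refine add_le_add (add_le_add (add_le_add le_rfl b2) b3) b44
    _ = (Kc + |c|) * I + J + K₂ * X + Y := e0

end L1

section Existence

variable {P : OscillatorChain} (hU : ContDiff ℝ ((⊤ : ℕ∞) : WithTop ℕ∞) P.U)
  (hV : ContDiff ℝ ((⊤ : ℕ∞) : WithTop ℕ∞) P.V) (hN : 0 < N) {T_L T_R : ℝ} (hTL : 0 ≤ T_L) (hTR : 0 ≤ T_R)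
  {ρ : PhaseSpace N → ℝ} (hρ : ContDiff ℝ 2 ρ) (hρ0 : ∀ x, 0 ≤ ρ x) (hρi : Integrable ρ)
  {c : ℝ} {g : PhaseSpace N → ℝ} (hg : Continuous g) (hgi : Integrable g)
  (hpde : ∀ x, sdeGenerator (fun y => -P.drift N y) (P.bathVecL N T_L) (P.bathVecR N T_R) ρ x +
    c * ρ x + g x = 0)
  (hvol : ∃ (C : ℝ) (d : ℕ), 0 ≤ C ∧ ∀ R : ℝ, 1 ≤ R →
    (volume {x : PhaseSpace N | P.hamiltonian N x ≤ 4 * R}).toReal ≤ C * R ^ d)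
include hU hV hN hTL hTR hρ hρ0 hρi hg hgi hpde hvol

/-- **Truncations with arbitrarily small defect (source case).** For every `η > 0` and all `M₀, R₀` there are
`M ≥ M₀`, `R ≥ R₀` (`M > 0`, `R ≥ 1`) such that `f = χ(H/R) m_M(ρ)` satisfies
`∫ |L̂ f + c f + χ(H/R) χ(ρ/M) g| ≤ η`. [folklore] -/
theorem exists_truncation_defect_le_src (hP : P.IsConfining) {η : ℝ} (hη : 0 < η) (M₀ R₀ : ℝ) :
    ∃ M R : ℝ, M₀ ≤ M ∧ R₀ ≤ R ∧ 0 < M ∧ 1 ≤ R ∧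
      ∫ x, |sdeGenerator (fun y => -P.drift N y) (P.bathVecL N T_L) (P.bathVecR N T_R)
            (fun y => smoothCutoff (P.hamiltonian N y / R) * ∫ σ in (0:ℝ)..ρ y, smoothCutoff (σ / M)) x +
          c * (smoothCutoff (P.hamiltonian N x / R) * ∫ σ in (0:ℝ)..ρ x, smoothCutoff (σ / M)) +
          smoothCutoff (P.hamiltonian N x / R) * smoothCutoff (ρ x / M) * g x| ≤ η := by
  obtain ⟨K₀, K₃, K₄, hK₀, hK₃, hK₄, hbound⟩ :=
    integral_abs_defect_le_src hU hV hN hTL hTR hρ hρ0 hρi hg hgi hpde hP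
  obtain ⟨Cv, d, hCv, hvolR⟩ := hvol
  have hU2 : ContDiff ℝ 2 P.U := hU.of_le (by norm_cast)
  have hV2 : ContDiff ℝ 2 P.V := hV.of_le (by norm_cast)
  have hHc : Continuous (P.hamiltonian N) := (P.contDiff_hamiltonian hU2 hV2 N).continuous
  set m₀ := ∫ x, ρ x with hm₀
  set mg := ∫ x, |g x| with hmg
  set m₁ := m₀ + mg with hm₁
  have hm₀0 : 0 ≤ m₀ := integral_nonneg hρ0
  have hmg0 : 0 ≤ mg := integral_nonneg fun x => abs_nonneg _
  have hm₁0 : 0 ≤ m₁ := add_nonneg hm₀0 hmg0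
  -- Step 1: the height (two terms)
  have h1 : ∀ᶠ M : ℝ in atTop, K₀ * (∫ x, (if M < ρ x then ρ x else 0)) +
      (∫ x, (if M < ρ x then |g x| else 0)) ≤ η / 3 := by
    have tA := (tendsto_integral_height_atTop hρ.continuous hρi).const_mul K₀
    have tB := tendsto_integral_height_abs_atTop (g := g) hρ.continuous hgi
    rw [mul_zero] at tA
    have t := tA.add tB
    rw [add_zero] at t
    exact t.eventually (ge_mem_nhds (by positivity : (0:ℝ) < η / 3))
  obtain ⟨M, hM1, hMM₀, hM0⟩ : ∃ M, (K₀ * (∫ x, (if M < ρ x then ρ x else 0)) +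
      (∫ x, (if M < ρ x then |g x| else 0)) ≤ η / 3) ∧ M₀ ≤ M ∧ 0 < M := by
    obtain ⟨M, hM⟩ := (h1.and ((eventually_ge_atTop M₀).and (eventually_gt_atTop 0))).exists
    exact ⟨M, hM.1, hM.2.1, hM.2.2⟩
  -- Step 2: the energy cutoff and the cross term, as functions of `R`
  set V : ℝ → ℝ := fun R => (volume {x : PhaseSpace N | P.hamiltonian N x ≤ 4 * R}).toReal with hVdef
  set W : ℝ → ℝ := fun R => 1 + Real.arsinh (2 * M * (1 + V R)) ^ 2 with hWdef
  have hV0 : ∀ R, 0 ≤ V R := fun R => ENNReal.toReal_nonneg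
  have hW1 : ∀ R, 1 ≤ W R := fun R => by
    simp only [hWdef]; nlinarith [sq_nonneg (Real.arsinh (2 * M * (1 + V R)))]
  have h2 : ∀ᶠ R : ℝ in atTop, K₃ * (∫ x, {x | R ≤ P.hamiltonian N x}.indicator ρ x) +
      K₄ * (2 * m₁ + 1) * Real.sqrt (W R / R) ≤ η / 3 + η / 3 := by
    have tA := (tendsto_integral_indicator_energy_atTop hHc hρi).const_mul K₃
    have tW := tendsto_weight_div_atTop hM0 hCv d (V := V) (fun R _ => hV0 R) hvolR
    have tB := (tW.sqrt).const_mul (K₄ * (2 * m₁ + 1))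
    rw [mul_zero] at tA
    rw [Real.sqrt_zero, mul_zero] at tB
    have hA := tA.eventually (ge_mem_nhds (by positivity : (0:ℝ) < η / 3))
    have hB := tB.eventually (ge_mem_nhds (by positivity : (0:ℝ) < η / 3))
    filter_upwards [hA, hB] with R hRA hRB
    exact add_le_add hRA hRB
  obtain ⟨R, hR2, hRR₀, hR1⟩ : ∃ R, (K₃ * (∫ x, {x | R ≤ P.hamiltonian N x}.indicator ρ x) +
      K₄ * (2 * m₁ + 1) * Real.sqrt (W R / R) ≤ η / 3 + η / 3) ∧ R₀ ≤ R ∧ 1 ≤ R := by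
    obtain ⟨R, hR⟩ := (h2.and ((eventually_ge_atTop R₀).and (eventually_ge_atTop 1))).exists
    exact ⟨R, hR.1, hR.2.1, hR.2.2⟩
  refine ⟨M, R, hMM₀, hRR₀, hM0, hR1, ?_⟩
  -- Step 3: the bound with `δ = 1/(1 + V R)`, `ε = 1/√(W R)`
  have hR0 : 0 < R := by linarith
  have hWR : 0 < W R := by linarith [hW1 R]
  set δ := 1 / (1 + V R) with hδ
  set ε := 1 / Real.sqrt (W R) with hε
  have hδ0 : 0 < δ := by rw [hδ]; exact div_pos one_pos (by linarith [hV0 R])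
  have hsW : 0 < Real.sqrt (W R) := Real.sqrt_pos.2 hWR
  have hε0 : 0 < ε := by rw [hε]; exact div_pos one_pos hsW
  have hb := hbound R M δ ε hR1 hM0 hδ0 hε0
  -- the cross term: `K₄/√R (ε W (m₀ + δ V) + m₁/ε) ≤ K₄ (2m₁+1) √(W/R)`
  have hδV : δ * V R ≤ 1 := by
    rw [hδ, div_mul_eq_mul_div, one_mul, div_le_one (by linarith [hV0 R])]
    linarith [hV0 R]
  have hεW : ε * (1 + Real.arsinh (2 * M / δ) ^ 2) = Real.sqrt (W R) := by
    have e1 : 2 * M / δ = 2 * M * (1 + V R) := by rw [hδ]; field_simp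
    have e2 : (1 + Real.arsinh (2 * M / δ) ^ 2) = W R := by rw [e1]
    rw [e2, hε, div_mul_eq_mul_div, one_mul, div_eq_iff hsW.ne', Real.mul_self_sqrt hWR.le]
  have hcross : K₄ / Real.sqrt R * (ε * (1 + Real.arsinh (2 * M / δ) ^ 2) * (m₀ + δ * V R) + m₁ / ε) ≤
      K₄ * (2 * m₁ + 1) * Real.sqrt (W R / R) := by
    rw [hεW]
    have e3 : m₁ / ε = m₁ * Real.sqrt (W R) := by rw [hε]; field_simp
    rw [e3, Real.sqrt_div hWR.le, show K₄ * (2 * m₁ + 1) * (Real.sqrt (W R) / Real.sqrt R) =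
      K₄ / Real.sqrt R * ((2 * m₁ + 1) * Real.sqrt (W R)) by ring]
    refine mul_le_mul_of_nonneg_left ?_ (div_nonneg hK₄ (Real.sqrt_nonneg _))
    have hm01 : m₀ ≤ m₁ := by rw [hm₁]; linarith
    nlinarith [mul_le_mul_of_nonneg_left hδV (mul_nonneg hsW.le hm₀0), hsW.le, hm₀0, hm₁0,
      mul_nonneg hsW.le (mul_nonneg hδ0.le (hV0 R)), mul_le_mul_of_nonneg_left hm01 hsW.le]
  calc _ ≤ K₀ * (∫ x, (if M < ρ x then ρ x else 0)) + (∫ x, (if M < ρ x then |g x| else 0)) +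
        K₃ * (∫ x, {x | R ≤ P.hamiltonian N x}.indicator ρ x) +
        K₄ / Real.sqrt R * (ε * (1 + Real.arsinh (2 * M / δ) ^ 2) * (m₀ + δ * V R) + m₁ / ε) := hb
    _ ≤ η / 3 + (η / 3 + η / 3) := by linarith [hM1, hR2, hcross]
    _ = η := by ring

end Existence

/-- Registered helper (notation-free restatement of `exists_truncation_defect_le_src`). -/
theorem helper_flipTruncationSmallDefect : ∀ (N : ℕ) (P : Literature.MathematicalPhysics.KineticTheory.HeatConduction.OscillatorChain), ContDiff ℝ ((⊤ : ℕ∞) : WithTop ℕ∞) P.U → ContDiff ℝ ((⊤ : ℕ∞) : WithTop ℕ∞) P.V → 0 < N → ∀ (T_L T_R : ℝ), 0 ≤ T_L → 0 ≤ T_R → ∀ (ρ : Literature.MathematicalPhysics.KineticTheory.HeatConduction.PhaseSpace N → ℝ), ContDiff ℝ 2 ρ → (∀ x, 0 ≤ ρ x) → MeasureTheory.Integrable ρ MeasureTheory.volume → ∀ (c : ℝ) (g : Literature.MathematicalPhysics.KineticTheory.HeatConduction.PhaseSpace N → ℝ), Continuous g → MeasureTheory.Integrable g MeasureTheory.volume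 → (∀ x, Literature.MathematicalPhysics.KineticTheory.sdeGenerator (fun y => -P.drift N y) (P.bathVecL N T_L) (P.bathVecR N T_R) ρ x + c * ρ x + g x = 0) → (∃ (C : ℝ) (d : ℕ), 0 ≤ C ∧ ∀ R : ℝ, 1 ≤ R → (MeasureTheory.volume {x : Literature.MathematicalPhysics.KineticTheory.HeatConduction.PhaseSpace N | P.hamiltonian N x ≤ 4 * R}).toReal ≤ C * R ^ d) → P.IsConfining → ∀ (η : ℝ), 0 < η → ∀ (M₀ R₀ : ℝ), ∃ M R : ℝ, M₀ ≤ M ∧ R₀ ≤ R ∧ 0 < M ∧ 1 ≤ R ∧ MeasureTheory.integral MeasureTheory.volume (fun x => |Literature.MathematicalPhysics.KineticTheory.sdeGenerator (fun y => -P.drift N y) (P.bathVecL N T_L) (P.bathVecR N T_R) (fun y => Literature.MathematicalPhysics.KineticTheory.HeatConduction.smoothCutoff (P.hamiltonian N y / R) * intervalIntegral (fun σ => Literature.MathematicalPhysics.KineticTheory.HeatConduction.smoothCutoff (σ / M)) 0 (ρ y) MeasureTheory.volume) x + c * (Literature.MathematicalPhysics.KineticTheory.HeatConduction.smoothCutoff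 (P.hamiltonian N x / R) * intervalIntegral (fun σ => Literature.MathematicalPhysics.KineticTheory.HeatConduction.smoothCutoff (σ / M)) 0 (ρ x) MeasureTheory.volume) + Literature.MathematicalPhysics.KineticTheory.HeatConduction.smoothCutoff (P.hamiltonian N x / R) * Literature.MathematicalPhysics.KineticTheory.HeatConduction.smoothCutoff (ρ x / M) * g x|) ≤ η :=
  fun _ _ hU hV hN _ _ hTL hTR _ hρ hρ0 hρi _ _ hg hgi hpde hvol hP _ hη M₀ R₀ =>
    exists_truncation_defect_le_src hU hV hN hTL hTR hρ hρ0 hρi hg hgi hpde hvol hP hη M₀ R₀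

end Summit.AtomisticToContinuum.FouriersLaw.Theorems.NoisyFourier.FlipResolvent

end
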